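import Summits.Schanuel.Schanuel.Theorems.SoloInformedAE3GelfondInput
import Summits.Schanuel.Schanuel.Theorems.SoloInformedTheoremAE1

/-!
# Theorem AE₃-1: `ν > 3 + β − 3σ` is an exponent of Roy's additive small value estimate

Soloist file (informed mode, seat `solo-Schanuel-informed`, s182).  The kernel form of the
seat's THEOREM AE₃-1 (`paper/AE-note.md` §14, `η = 0` form) on the node
`RoyAdditiveDirichletExponent` ([cite: Roy2010, Thm 1.1], the additive small value estimate;
Roy's question there is whether every `ν > 1 + β − σ − τ` is an exponent):

  for `ξ ∈ ℂ` transcendental, `β > 1` and `0 < σ < 1` (any `τ`), every `ν > 3 + β − 3σ` lies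
  in `royAdditiveSVEExponents ξ β σ τ` — i.e. for infinitely many `n` there is NO non-zero
  `P ∈ ℤ[X]` with `deg P ≤ n`, `H(P) ≤ exp(n^β)` and `|P^{[j]}(iξ)| ≤ exp(-n^ν)` for all
  naturals `i ≤ n^σ`, `j ≤ n^τ`.

This supersedes the seat's THEOREM AE-1 (`soloT1_Ioi_subset_royAdditiveSVEExponents`,
threshold `4 + β − 4σ`) for every `σ < 1` and improves the one-point Gel'fond ceiling
`ν > 1 + β` (`Ioi_subset_royAdditiveSVEExponents`) exactly when `σ > 2/3`, still using only
the points `iξ` (no derivatives).  The single change in the argument is the price list: the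
violated THREE-TERM PROGRESSIONS of served roots are counted by LEMMA AE₃
(`soloAP_lemmaAE3`: `a^{3D²} ∏ (ρ_i + ρ_k − 2ρ_j) ∈ ℤ ∖ {0}`, price `3 D² log M + D³ log 4`)
instead of the violated additive coincidences of Lemma AE (price `≍ D³ log M`), and THEOREM C₃
(`soloAR_even_affine_of_few_violated_progressions`) converts `≤ 5·10⁻⁶ K²` violated
progressions into an affine law on half of the points; the budget `K³ n^ν ≫ n³ n^β`
(`K = ⌊n^σ⌋`) replaces `K⁴ n^ν ≫ n⁴ n^β`.  Steps 4–6 are unchanged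
(`soloG3_gelfond_input`: a dilated cheap factor `Q_n` of degree `O(n^{1-σ})`, type
`O(n^{1-σ} log n + n^{β-σ})`, `|Q_n(ξ)| ≤ exp(-n^ν K / (160000 n))`; Gel'fond's criterion
`Literature.NumberTheory.Transcendental.gelfond_criterion_not_small_values` with the sequences
`(N+1)^{e₁}`, `(N+1)^{e₂}`, `e₁ = 1 − σ + κ`, `e₂ = β − σ + κ`, `κ = σ/2`, ratio
`a = 2^{e₂} + 1`, legitimate because `e₁ + e₂ = 1 + β − σ < ν + σ − 1`).  The eventual
inequalities with the new constant `W = n^ν K / (80000 n)` are deduced from those of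
`SoloInformedTheoremAE1` at a slightly smaller exponent `ν' < ν` (`400 n^{ν'} ≤ n^ν`
eventually, `soloT3_W_compare`); `soloT3_condD` is where `ν > 3 + β − 3σ` is used.

What this is NOT.  Not the node `RoyAdditiveDirichletExponent` (threshold `1 + β − σ − τ`),
which stays open; the window `(1 + β − σ − τ, 3 + β − 3σ]` is untouched, and nothing here
bears on `Literature.Periods.SchanuelConjecture` (the seat's verdict, no path, is unchanged).
The argument is the seat's own (AE-note §2–§7, §14); the ingredients are classical (Gel'fond's
criterion, Mahler measure, Lemma H, symmetric functions) and no literature hypothesis is used: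
tree files and Mathlib only; no definitions; axioms the standard three.
-/

namespace Summit.Schanuel.Schanuel.Theorems

open Polynomial Finset Filter

/-! ## Eventual inequalities (`K = ⌊n^σ⌋`, `W = n^ν K / (80000 n)`) -/

/-- Eventually `n ≥ 1`, `K = ⌊n^σ⌋ ≥ 2000` and `n^σ / 2 ≤ K ≤ n^σ`. -/
theorem soloT3_floor {σ : ℝ} (hσ0 : 0 < σ) :
    ∀ᶠ n : ℕ in atTop, (1 : ℝ) ≤ n ∧ 2000 ≤ ⌊(n : ℝ) ^ σ⌋₊ ∧
      (⌊(n : ℝ) ^ σ⌋₊ : ℝ) ≤ (n : ℝ) ^ σ ∧ (n : ℝ) ^ σ / 2 ≤ ⌊(n : ℝ) ^ σ⌋₊ := by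
  filter_upwards [eventually_ge_atTop 1, eventually_const_mul_rpow_le_rpow hσ0 4000]
    with n hn h
  have hn1 : (1 : ℝ) ≤ n := by exact_mod_cast hn
  rw [Real.rpow_zero, mul_one] at h
  have hpos : 0 ≤ (n : ℝ) ^ σ := by positivity
  have hfl : (n : ℝ) ^ σ - 1 < ⌊(n : ℝ) ^ σ⌋₊ := Nat.sub_one_lt_floor _
  refine ⟨hn1, ?_, Nat.floor_le hpos, by linarith⟩
  have : (2000 : ℝ) ≤ ⌊(n : ℝ) ^ σ⌋₊ := by linarith
  exact_mod_cast this

/-- The comparison with the constants of `SoloInformedTheoremAE1`: for `ν' < ν`, eventually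
`n^{ν'} K / (200 n) ≤ n^ν K / (80000 n)` and `n^{ν'} K / (400 n) ≤ n^ν K / (160000 n)`. -/
theorem soloT3_W_compare (σ : ℝ) {ν ν' : ℝ} (h : ν' < ν) :
    ∀ᶠ n : ℕ in atTop,
      (n : ℝ) ^ ν' * ⌊(n : ℝ) ^ σ⌋₊ / (200 * n) ≤ (n : ℝ) ^ ν * ⌊(n : ℝ) ^ σ⌋₊ / (80000 * n) ∧
        (n : ℝ) ^ ν' * ⌊(n : ℝ) ^ σ⌋₊ / (400 * n) ≤
          (n : ℝ) ^ ν * ⌊(n : ℝ) ^ σ⌋₊ / (160000 * n) := by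
  filter_upwards [eventually_ge_atTop 1, eventually_const_mul_rpow_le_rpow h 400] with n hn hc
  have hn0 : (0 : ℝ) < n := by exact_mod_cast hn
  have hK0 : (0 : ℝ) ≤ ⌊(n : ℝ) ^ σ⌋₊ := Nat.cast_nonneg _
  have base : 400 * ((n : ℝ) ^ ν' * ⌊(n : ℝ) ^ σ⌋₊) ≤ (n : ℝ) ^ ν * ⌊(n : ℝ) ^ σ⌋₊ := by
    rw [← mul_assoc]
    exact mul_le_mul_of_nonneg_right hc hK0
  constructor
  · rw [show (n : ℝ) ^ ν' * ⌊(n : ℝ) ^ σ⌋₊ / (200 * n) =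
        400 * ((n : ℝ) ^ ν' * ⌊(n : ℝ) ^ σ⌋₊) / (80000 * n) by field_simp; ring]
    exact div_le_div_of_nonneg_right base (by positivity)
  · rw [show (n : ℝ) ^ ν' * ⌊(n : ℝ) ^ σ⌋₊ / (400 * n) =
        400 * ((n : ℝ) ^ ν' * ⌊(n : ℝ) ^ σ⌋₊) / (160000 * n) by field_simp; ring]
    exact div_le_div_of_nonneg_right base (by positivity)

/-- (C₃) eventually `log 4 ≤ W / 2` (`ν > 1`). -/
theorem soloT3_condC {σ ν : ℝ} (hσ0 : 0 < σ) (hν : 1 < ν) :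
    ∀ᶠ n : ℕ in atTop, Real.log 4 ≤ (n : ℝ) ^ ν * ⌊(n : ℝ) ^ σ⌋₊ / (160000 * n) := by
  have hν' : 1 < (1 + ν) / 2 := by linarith
  have hlt : (1 + ν) / 2 < ν := by linarith
  filter_upwards [soloT1_condC (1 : ℂ) hσ0 hν', soloT3_W_compare σ hlt] with n h hc
  have hK0 : (0 : ℝ) ≤ ⌊(n : ℝ) ^ σ⌋₊ := Nat.cast_nonneg _
  have h4 : Real.log 4 ≤ Real.log (8 * (⌊(n : ℝ) ^ σ⌋₊ * ‖(1 : ℂ)‖ + 1)) :=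
    Real.log_le_log (by norm_num) (by rw [norm_one, mul_one]; linarith)
  exact h4.trans (h.trans hc.2)

/-- (D₃) eventually `2.88·10¹¹ n³ n^β ≤ K³ n^ν` — THIS is where `ν > 3 + β − 3σ` is used. -/
theorem soloT3_condD {β σ ν : ℝ} (hσ0 : 0 < σ) (hν : 3 + β - 3 * σ < ν) :
    ∀ᶠ n : ℕ in atTop, 288000000000 * ((n : ℝ) ^ 3 * (n : ℝ) ^ β) ≤
      (⌊(n : ℝ) ^ σ⌋₊ : ℝ) ^ 3 * (n : ℝ) ^ ν := by
  have hlt : 3 + β < 3 * σ + ν := by linarith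
  filter_upwards [soloT1_floor hσ0, eventually_const_mul_rpow_le_rpow hlt 2304000000000]
    with n ⟨hn1, hK, hKle, hKge⟩ h
  have hn0 : (0 : ℝ) < n := by linarith
  have e1 : (n : ℝ) ^ 3 * (n : ℝ) ^ β = (n : ℝ) ^ (3 + β) := by
    rw [Real.rpow_add hn0, show (3 : ℝ) = ((3 : ℕ) : ℝ) by norm_num, Real.rpow_natCast]
  have e2 : (n : ℝ) ^ (3 * σ + ν) = ((n : ℝ) ^ σ) ^ 3 * (n : ℝ) ^ ν := by
    rw [Real.rpow_add hn0, mul_comm (3 : ℝ) σ, Real.rpow_mul hn0.le,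
      show (3 : ℝ) = ((3 : ℕ) : ℝ) by norm_num, Real.rpow_natCast]
  have hK3 : ((n : ℝ) ^ σ) ^ 3 / 8 ≤ (⌊(n : ℝ) ^ σ⌋₊ : ℝ) ^ 3 := by
    have := pow_le_pow_left₀ (by positivity : 0 ≤ (n : ℝ) ^ σ / 2) hKge 3
    calc ((n : ℝ) ^ σ) ^ 3 / 8 = ((n : ℝ) ^ σ / 2) ^ 3 := by ring
      _ ≤ _ := this
  calc 288000000000 * ((n : ℝ) ^ 3 * (n : ℝ) ^ β)
      = 288000000000 * (n : ℝ) ^ (3 + β) := by rw [e1]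
    _ ≤ (n : ℝ) ^ (3 * σ + ν) / 8 := by linarith
    _ = ((n : ℝ) ^ σ) ^ 3 / 8 * (n : ℝ) ^ ν := by rw [e2]; ring
    _ ≤ (⌊(n : ℝ) ^ σ⌋₊ : ℝ) ^ 3 * (n : ℝ) ^ ν :=
        mul_le_mul_of_nonneg_right hK3 (by positivity)

/-- (E₃) eventually `(20 n / K) log (K‖ξ‖ + 1) + 40 n^β / K ≤ W / 2`. -/
theorem soloT3_condE (ξ : ℂ) {β σ ν : ℝ} (hσ0 : 0 < σ) (hm1 : 1 < ν + σ - 1)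
    (hm2 : β - σ < ν + σ - 1) :
    ∀ᶠ n : ℕ in atTop,
      20 * n / ⌊(n : ℝ) ^ σ⌋₊ * Real.log (⌊(n : ℝ) ^ σ⌋₊ * ‖ξ‖ + 1) +
        40 * (n : ℝ) ^ β / ⌊(n : ℝ) ^ σ⌋₊ ≤ (n : ℝ) ^ ν * ⌊(n : ℝ) ^ σ⌋₊ / (160000 * n) := by
  set δ : ℝ := min (ν + σ - 1 - 1) (ν + σ - 1 - (β - σ)) / 2 with hδ
  have hδ0 : 0 < δ := by
    rw [hδ]; exact half_pos (lt_min (by linarith) (by linarith))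
  have hδ1 : δ < ν + σ - 1 - 1 := by
    have := min_le_left (ν + σ - 1 - 1) (ν + σ - 1 - (β - σ))
    rw [hδ]; linarith
  have hδ2 : δ < ν + σ - 1 - (β - σ) := by
    have := min_le_right (ν + σ - 1 - 1) (ν + σ - 1 - (β - σ))
    rw [hδ]; linarith
  have hlt : ν - δ < ν := by linarith
  filter_upwards [soloT1_condE ξ hσ0 (β := β) (ν := ν - δ) (by linarith) (by linarith),
    soloT3_W_compare σ hlt] with n h hc
  exact h.trans hc.2

/-- (H₃) eventually `40 a (n+1)^{e₁} (n+1)^{e₂} < W / 2` (`e₁ + e₂ < ν + σ − 1`). -/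
theorem soloT3_condH {σ ν e₁ e₂ : ℝ} (hσ0 : 0 < σ) (he₁ : 0 ≤ e₁) (he₂ : 0 ≤ e₂)
    (hE : e₁ + e₂ < ν + σ - 1) {a : ℝ} (ha : 0 < a) :
    ∀ᶠ n : ℕ in atTop, 40 * a * ((n : ℝ) + 1) ^ e₁ * ((n : ℝ) + 1) ^ e₂ <
      (n : ℝ) ^ ν * ⌊(n : ℝ) ^ σ⌋₊ / (160000 * n) := by
  set δ : ℝ := (ν + σ - 1 - (e₁ + e₂)) / 2 with hδ
  have hlt : ν - δ < ν := by rw [hδ]; linarith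
  have hE' : e₁ + e₂ < ν - δ + σ - 1 := by rw [hδ]; linarith
  filter_upwards [soloT1_condH hσ0 he₁ he₂ hE' ha, soloT3_W_compare σ hlt] with n h hc
  exact h.trans_le hc.2

/-! ## Theorem AE₃-1 -/

/-- **THEOREM AE₃-1 (kernel form).**  For `ξ` transcendental, `β > 1`, `0 < σ < 1` and any
`τ`: every `ν > 3 + β − 3σ` is an exponent of Roy's additive small value estimate at the
points `iξ`, i.e. `Set.Ioi (3 + β - 3σ) ⊆ royAdditiveSVEExponents ξ β σ τ`. -/
theorem soloT3_Ioi_subset_royAdditiveSVEExponents {ξ : ℂ} (hξ : Transcendental ℚ ξ)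
    {β σ : ℝ} (τ : ℝ) (hβ : 1 < β) (hσ0 : 0 < σ) (hσ1 : σ < 1) :
    Set.Ioi (3 + β - 3 * σ) ⊆ royAdditiveSVEExponents ξ β σ τ := by
  intro ν hν
  rw [Set.mem_Ioi] at hν
  by_contra hcon
  have hev : ∀ᶠ n : ℕ in atTop, (RoyAdditiveSmall ξ β σ τ ν n).Nonempty :=
    (Filter.not_frequently.mp hcon).mono fun n hn => not_not.mp hn
  have hξ0 : ξ ≠ 0 := by
    intro h
    apply hξ
    rw [h]
    exact isAlgebraic_zero
  have hξpos : 0 < ‖ξ‖ := norm_pos_iff.mpr hξ0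
  -- the constant `c₁` of the served-set lemma
  set c₁ : ℝ := max 0 (Real.log (2 / ‖ξ‖)) with hc₁
  have hc : Real.exp (-c₁) ≤ min 1 (‖ξ‖ / 2) := by
    refine le_min ?_ ?_
    · rw [Real.exp_le_one_iff]
      linarith [le_max_left 0 (Real.log (2 / ‖ξ‖))]
    · have h2 : 0 < 2 / ‖ξ‖ := by positivity
      calc Real.exp (-c₁) ≤ Real.exp (-Real.log (2 / ‖ξ‖)) :=
            Real.exp_le_exp.mpr (by linarith [le_max_right 0 (Real.log (2 / ‖ξ‖))])
        _ = ‖ξ‖ / 2 := by rw [Real.exp_neg, Real.exp_log h2, inv_div]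
  -- exponents of the comparison sequences
  set κ : ℝ := σ / 2 with hκ
  have hκ0 : 0 < κ := by rw [hκ]; linarith
  set e₁ : ℝ := 1 - σ + κ with he₁
  set e₂ : ℝ := β - σ + κ with he₂
  have he₁0 : 0 < e₁ := by rw [he₁]; linarith
  have he₂0 : 0 < e₂ := by rw [he₂]; linarith
  have he12 : e₁ ≤ e₂ := by rw [he₁, he₂]; linarith
  have hE : e₁ + e₂ < ν + σ - 1 := by rw [he₁, he₂, hκ]; linarith
  set a : ℝ := (2 : ℝ) ^ e₂ + 1 with ha_def
  have h2e₂ : 0 < (2 : ℝ) ^ e₂ := by positivity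
  have ha1 : 1 < a := by linarith
  have ha0 : 0 < a := by linarith
  have h2e₁ : (2 : ℝ) ^ e₁ ≤ (2 : ℝ) ^ e₂ :=
    Real.rpow_le_rpow_of_exponent_le (by norm_num) he12
  -- all eventual conditions at once
  have hν1 : 1 < ν := by linarith
  have hall := hev.and ((eventually_ge_atTop 1).and ((soloT3_floor hσ0).and
    ((soloT1_condA hν1 c₁).and ((soloT3_condC hσ0 hν1).and ((soloT3_condD hσ0 hν).and
    ((soloT3_condE ξ hσ0 (β := β) (ν := ν) (by linarith) (by linarith)).and
    ((soloT1_condF hσ0 hσ1 (e₁ := e₁) (by rw [he₁]; linarith)).and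
    ((soloT1_condG (β := β) hσ0 hσ1 hκ0 (e₂ := e₂) (by rw [he₂]; linarith)
      (by rw [he₂]; linarith) (by rw [he₂]; linarith)).and
    (soloT3_condH (ν := ν) hσ0 he₁0.le he₂0.le hE ha0)))))))))
  obtain ⟨N₀, hN₀⟩ := Filter.eventually_atTop.mp hall
  -- the Gel'fond inputs `Q n`, `n ≥ N₀` (junk `1` below `N₀`)
  have hex : ∀ n : ℕ, ∃ Q : ℤ[X], N₀ ≤ n →
      Q ≠ 0 ∧ (Q.natDegree : ℝ) ≤ 20 * n / ⌊(n : ℝ) ^ σ⌋₊ ∧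
        Q.gelfondType ≤ 20 * n / ⌊(n : ℝ) ^ σ⌋₊ * (2 + Real.log ⌊(n : ℝ) ^ σ⌋₊) +
          40 * (n : ℝ) ^ β / ⌊(n : ℝ) ^ σ⌋₊ ∧
        ‖aeval ξ Q‖ ≤ Real.exp (-((n : ℝ) ^ ν * ⌊(n : ℝ) ^ σ⌋₊ / (160000 * n))) := by
    intro n
    by_cases h : N₀ ≤ n
    · obtain ⟨hne, hn1, ⟨-, hK, hKle, -⟩, h₁, h₄, h₅, h₆, -⟩ := hN₀ n h
      obtain ⟨Q, hQ⟩ := soloG3_gelfond_input hξ hβ.le hn1 hK hKle hc h₁ h₄ h₅ h₆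
        hne.some_mem
      exact ⟨Q, fun _ => hQ⟩
    · exact ⟨1, fun h' => absurd h' h⟩
  choose Q hQ using hex
  -- Gel'fond's criterion with `δ_N = (N+1)^{e₁}`, `σ_N = (N+1)^{e₂}`
  obtain ⟨hδm, hδ0, -, hδr⟩ := soloT1_seq he₁0
  obtain ⟨hσm, hσ0', hσt, hσr⟩ := soloT1_seq he₂0
  have hδa : ∀ N : ℕ, (((N + 1 : ℕ) : ℝ) + 1) ^ e₁ ≤ a * (((N : ℝ) + 1) ^ e₁) := fun N => by
    have hp : 0 < ((N : ℝ) + 1) ^ e₁ := hδ0 N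
    calc (((N + 1 : ℕ) : ℝ) + 1) ^ e₁ ≤ (2 : ℝ) ^ e₁ * ((N : ℝ) + 1) ^ e₁ := hδr N
      _ ≤ a * ((N : ℝ) + 1) ^ e₁ := by
          apply mul_le_mul_of_nonneg_right _ hp.le
          linarith
  have hσa : ∀ N : ℕ, (((N + 1 : ℕ) : ℝ) + 1) ^ e₂ < a * (((N : ℝ) + 1) ^ e₂) := fun N => by
    have hp : 0 < ((N : ℝ) + 1) ^ e₂ := hσ0' N
    calc (((N + 1 : ℕ) : ℝ) + 1) ^ e₂ ≤ (2 : ℝ) ^ e₂ * ((N : ℝ) + 1) ^ e₂ := hσr N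
      _ < a * ((N : ℝ) + 1) ^ e₂ := by
          apply mul_lt_mul_of_pos_right _ hp
          linarith
  have hQcrit : ∀ N, N₀ ≤ N → Q N ≠ 0 ∧ ((Q N).natDegree : ℝ) < ((N : ℝ) + 1) ^ e₁ ∧
      (Q N).gelfondType < ((N : ℝ) + 1) ^ e₂ := fun N hN => by
    obtain ⟨hQ0, hQd, hQt, -⟩ := hQ N hN
    obtain ⟨-, -, -, -, -, -, -, hF, hG, -⟩ := hN₀ N hN
    exact ⟨hQ0, hQd.trans_lt hF, hQt.trans_lt hG⟩
  obtain ⟨N, hNN₀, hlow⟩ :=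
    Literature.NumberTheory.Transcendental.gelfond_criterion_not_small_values hξ a ha1
      (fun N : ℕ => ((N : ℝ) + 1) ^ e₁) (fun N : ℕ => ((N : ℝ) + 1) ^ e₂) hδm hσm hδ0 hσ0'
      hσt hδa hσa Q N₀ hQcrit
  -- compare the two bounds at this `N`
  obtain ⟨-, -, -, hup⟩ := hQ N hNN₀
  obtain ⟨-, -, -, -, -, -, -, -, -, hH⟩ := hN₀ N hNN₀
  have hcmp := Real.exp_le_exp.mp (hlow.trans hup)
  linarith

/-- **Corollary.**  For `ξ` transcendental, `β > 1`, `2/3 < σ < 1`: the exponent set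
`royAdditiveSVEExponents ξ β σ τ` contains `Set.Ioi (min (1 + β) (3 + β - 3σ))` — the
one-point Gel'fond ceiling and THEOREM AE₃-1 combined (the minimum is the AE₃-1 threshold
iff `σ > 2/3`). -/
theorem soloT3_Ioi_min_subset_royAdditiveSVEExponents {ξ : ℂ} (hξ : Transcendental ℚ ξ)
    {β σ : ℝ} (τ : ℝ) (hβ : 1 < β) (hσ0 : 0 < σ) (hσ1 : σ < 1) :
    Set.Ioi (min (1 + β) (3 + β - 3 * σ)) ⊆ royAdditiveSVEExponents ξ β σ τ := by
  intro ν hν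
  rw [Set.mem_Ioi, min_lt_iff] at hν
  rcases hν with h | h
  · exact Ioi_subset_royAdditiveSVEExponents hξ τ hσ0.le hβ.le (Set.mem_Ioi.mpr h)
  · exact soloT3_Ioi_subset_royAdditiveSVEExponents hξ τ hβ hσ0 hσ1 (Set.mem_Ioi.mpr h)

end Summit.Schanuel.Schanuel.Theorems
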